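import Summits.BirchSwinnertonDyer.BirchSwinnertonDyer.Theorems.GenusKolyvaginAtTwoShaCardDvdPowAtTwoPosTB2QSignFree
import HarnessLib

/-!
# Route `GenusKolyvaginAtTwo`, crux K₄⁺ `K4Pos` (stmt-BirchSwinnertonDyer-31469; sign-free, so also K₄ `K4Neg` 31526) —
# THE HALF-POINT CLASS: the Kolyvagin cocycle of `Q` when `P(n) = 2Q`, and `ι_M c_M(Q) = c_{M+1}(P(n))`

Width seat `bsd-line-gk2-p5` g36 (cell `bsd-f1-sign2`), `--supports stmt-BirchSwinnertonDyer-31469 --as helper`.  THEOREMS ONLY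
(no definition, no named fact, no `sorry`).  BSD is NOT proved by this file; nothing is closed.  Input of the HALVING DESCENT
(`…KFourPosHalvingDescent`): if a derived point is `2`-divisible, `P(n) = 2·Q` in `E(K[n])`, then McCallum's cocycle of the HALF point `Q`
at level `2^M` (same root as the cocycle of `P(n)` at level `2^{M+1}`) is a class `x' ∈ H¹(K, E[2^M])` whose change of level is
`c_{M+1}(n)` — an identity of cocycles, value by value (§1 generic over any topological group and discrete module, §2 for Heegner data).
[McCallumLMS1991] §4 Lemma 4.1, (6), Lemma 4.6; [GrossLMS1991] §4 (4.4)–(4.6).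
-/

set_option autoImplicit false
-- the Theorems namespace of this sub repeats the summit name by design (D-0017 nested layout)
set_option linter.dupNamespace false

noncomputable section

open scoped Classical
open scoped AddSubgroup

universe u

namespace Summit.BirchSwinnertonDyer.BirchSwinnertonDyer.Theorems.GenusExact.PlusDescent

open WeierstrassCurve NumberField IsDedekindDomain Field Rat.HeightOneSpectrum Literature.NumberTheory.EllipticCurves
  Literature.NumberTheory.GaloisRepresentations Literature.NumberTheory.EllipticCurves.ModularForms AddSubgroup
  Literature.NumberTheory.EllipticCurves.RingClassField
open Literature.NumberTheory.EllipticCurves.KolyvaginCocycle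
open Summit.BirchSwinnertonDyer.BirchSwinnertonDyer.Theses.GenusKolyvaginAtTwo (KolyvaginRelationAtTwo)
open Summit.BirchSwinnertonDyer.Rank1Residual
open Summit.BirchSwinnertonDyer.BirchSwinnertonDyer.Theorems.GenusExact
open Summit.BirchSwinnertonDyer.BirchSwinnertonDyer.Theorems.GenusExact.VisiblePairAtTwo
  (liesOver_of_natCast_mem natCast_mem_primesEquiv_symm natCast_prime_mem_iff_eq hasGoodReductionAt_of_hasGoodReductionAtPrime
    not_mem_range intCast_notMem_of_not_dvd)
open Summit.BirchSwinnertonDyer.BirchSwinnertonDyer.Theorems.OffBigImageOddLocalAtTwo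


/-! ## §1 Generic: the cocycle of a point and of a multiple of it, with a common root, at two levels `d ∣ N = m·d` -/

section Generic

variable {G : Type u} [Group G] [TopologicalSpace G] [IsTopologicalGroup G]
variable {M : Type u} [AddCommGroup M] [DistribMulAction G M] [TopologicalSpace M] [DiscreteTopology M]
variable {A : AddSubgroup M} {d N : ℤ}

/-- **The half-point identity of McCallum cocycles, generic form.**  Levels `N = m·d`, an admissible `A` (for `N` and for `d`),
`P₀ ∈ invPoints` at level `d` and `P = m·P₀ ∈ invPoints` at level `N`, and ONE common root `Q` (`d·Q = P₀`, hence `N·Q = P`): the image of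
the level-`d` class `c_d(P₀; Q) ∈ H¹(G, M[d])` under the change of level `H¹(G, M[d]) → H¹(G, M[N])` is the level-`N` class `c_N(P; Q)`.
The two cocycles `g ↦ gQ − Q − (g−1)P₀/d` and `g ↦ gQ − Q − (g−1)P/N` agree VALUE BY VALUE in `M`, because `(g−1)(mP₀)/N = (g−1)P₀/d` by
uniqueness of division in `A`. [cite: McCallumLMS1991, §4 Lemma 4.1, Lemma 4.6] -/
theorem map_inclusion_cls_eq_cls_of_zsmul_eq {m : ℤ} (hm : N = m * d)
    (hle : AddSubgroup.torsionBy M d ≤ AddSubgroup.torsionBy M N)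
    (hAN : IsAdmissible G A N) (hAd : IsAdmissible G A d) (hcont : ∀ x : M, Continuous fun g : G ↦ g • x)
    {P₀ P : M} (hP₀ : P₀ ∈ invPoints G A d) (hP : P ∈ invPoints G A N) (hmP : m • P₀ = P)
    {Q : M} (hQd : d • Q = P₀) (hQN : N • Q = P) :
    ContinuousCohomology.map (ContinuousMonoidHom.id G)
        (resHomOfEquivariant (ContinuousMonoidHom.id G) (AddSubgroup.inclusion hle) (fun _ _ ↦ rfl)) 1
        (cls hAd hcont hP₀ hQd) = cls hAN hcont hP hQN := by
  subst hmP
  unfold cls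
  rw [map_oneCocycleClass]
  refine oneCocycleClass_congr_val fun g ↦ ?_
  change ((AddSubgroup.inclusion hle ((cocycle hAd hcont hP₀ hQd).1 g) : AddSubgroup.torsionBy M N) : M) =
    g • Q - Q - rootIn A N (g • (m • P₀) - m • P₀)
  rw [AddSubgroup.coe_inclusion, coe_cocycle_apply, smul_zsmul_comm, ← zsmul_sub]
  congr 1
  symm
  refine rootIn_eq hAN.eq_zero_of_zsmul (rootIn_smul_sub_spec hP₀ g).1 ?_
  rw [hm, mul_smul, (rootIn_smul_sub_spec hP₀ g).2]

end Generic

/-! ## §2 Heegner data: the class of the HALF of a `2`-divisible derived point -/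

section Heegner

variable {K : Type} [Field K] [NumberField K] {W : WeierstrassCurve ℚ} {Nc : ℕ} [NeZero Nc]
variable {Dt : ModularParametrizationData W Nc} {β : ℤ} {ι : K →+* ℂ} {n : ℕ}

/-- **The half-point class.**  For a Heegner datum `d` of conductor `n` whose derived point is `2`-divisible in `E(K[n])`, `P(n) = 2·Q`, and a
level `M` such that McCallum's standing inputs hold AT LEVEL `M+1` (`A = E(K[n]) ⊆ E(K̄)` admissible for `2^{M+1}`, `[P(n)]` invariant mod
`2^{M+1}` — automatic for Kolyvagin primes of index `≥ M+1`), there is a class `x' ∈ H¹(K, E[2^M])` — the Kolyvagin class of `Q` at level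
`2^M` — whose change of level to `2^{M+1}` is `c_{M+1}(n)`:  `ι_M x' = c_{M+1}(n)`.  (`Q` is invariant mod `2^M·A` because `2·((g−1)Q) =
(g−1)P(n) ∈ 2^{M+1}·A` and `A` has no `2`-torsion.) [cite: McCallumLMS1991, §4 Lemma 4.1, (6), Lemma 4.6] -/
theorem exists_torsionH1OfDvd_eq_kolyvaginClass_succ_of_two_zsmul_eq (d : KolyvaginHeegnerData Dt β ι n) {M : ℕ}
    (hA1 : IsAdmissible (Field.absoluteGaloisGroup K) d.pointsSubgroup ((2 ^ (M + 1) : ℕ) : ℤ))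
    (hP1 : d.toGeomPoints d.derivedPoint ∈ invPoints (Field.absoluteGaloisGroup K) d.pointsSubgroup ((2 ^ (M + 1) : ℕ) : ℤ))
    {Qh : (W.baseChange (ringClassField K ι n)).toAffine.Point} (hQh : (2 : ℤ) • Qh = d.derivedPoint) :
    ∃ x' : galH1Torsion (W.baseChange K) ((2 ^ M : ℕ) : ℤ),
      torsionH1OfDvd (W.baseChange K) (natCast_pow_dvd_natCast_pow (p := 2) (Nat.le_succ M)) x' =
        d.kolyvaginClass Nat.prime_two (M + 1) := by
  have hdvd : ((2 ^ M : ℕ) : ℤ) ∣ ((2 ^ (M + 1) : ℕ) : ℤ) := natCast_pow_dvd_natCast_pow (p := 2) (Nat.le_succ M)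
  have hm : ((2 ^ (M + 1) : ℕ) : ℤ) = (2 : ℤ) * ((2 ^ M : ℕ) : ℤ) := by push_cast; ring
  have hA0 : IsAdmissible (Field.absoluteGaloisGroup K) d.pointsSubgroup ((2 ^ M : ℕ) : ℤ) := isAdmissible_of_dvd hdvd hA1
  -- the half point in `E(K̄)` and its invariance mod `2^M · A`
  set Q' : geomPoints (W.baseChange K) := d.toGeomPoints Qh with hQ'def
  have hQ'A : Q' ∈ d.pointsSubgroup := ⟨Qh, rfl⟩
  have h2Q' : (2 : ℤ) • Q' = d.toGeomPoints d.derivedPoint := by rw [hQ'def, ← map_zsmul, hQh]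
  have hQ'inv : Q' ∈ invPoints (Field.absoluteGaloisGroup K) d.pointsSubgroup ((2 ^ M : ℕ) : ℤ) := by
    refine ⟨hQ'A, fun g ↦ ?_⟩
    obtain ⟨R, hR, hRe⟩ := hP1.2 g
    refine ⟨R, hR, ?_⟩
    -- `2 • (2^M • R - (gQ' - Q')) = 0` in the `2^{M+1}`-torsion-free group `A`
    have hmemA : ((2 ^ M : ℕ) : ℤ) • R - (g • Q' - Q') ∈ d.pointsSubgroup :=
      d.pointsSubgroup.sub_mem (d.pointsSubgroup.zsmul_mem hR _) (d.pointsSubgroup.sub_mem (hA1.smul_mem g hQ'A) hQ'A)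
    have hzero : ((2 ^ (M + 1) : ℕ) : ℤ) • (((2 ^ M : ℕ) : ℤ) • R - (g • Q' - Q')) = 0 := by
      have h2 : (2 : ℤ) • (((2 ^ M : ℕ) : ℤ) • R - (g • Q' - Q')) = 0 := by
        rw [zsmul_sub, smul_smul, ← hm, hRe, zsmul_sub, ← smul_zsmul_comm, h2Q', sub_self]
      rw [hm, mul_comm, mul_smul, h2, zsmul_zero]
    exact sub_eq_zero.mp (hA1.eq_zero_of_zsmul hmemA hzero)
  -- a common root: `2^M • R₀ = Q'`, hence `2^{M+1} • R₀ = P(n)`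
  have hdivM : ∀ P : geomPoints (W.baseChange K), ∃ R : geomPoints (W.baseChange K), ((2 ^ M : ℕ) : ℤ) • R = P :=
    (W.baseChange K).zsmul_geomPoints_surjective_of_charZero (by positivity)
  obtain ⟨R₀, hR₀⟩ := hdivM Q'
  have hR₀' : ((2 ^ (M + 1) : ℕ) : ℤ) • R₀ = d.toGeomPoints d.derivedPoint := by rw [hm, mul_smul, hR₀, h2Q']
  refine ⟨Literature.NumberTheory.EllipticCurves.kolyvaginClass (W.baseChange K) ((2 ^ M : ℕ) : ℤ) hdivM hA0 Q' hQ'inv, ?_⟩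
  rw [d.kolyvaginClass_of_admissible Nat.prime_two (M + 1) hA1 hP1,
    kolyvaginClass_eq_cls hA0 hQ'inv hR₀, kolyvaginClass_eq_cls hA1 hP1 hR₀']
  exact map_inclusion_cls_eq_cls_of_zsmul_eq hm (geomTorsion_le_of_dvd (W.baseChange K) hdvd) hA1 hA0
    (continuous_smul_geomPoints (W.baseChange K)) hQ'inv hP1 h2Q' hR₀ hR₀'

end Heegner

end Summit.BirchSwinnertonDyer.BirchSwinnertonDyer.Theorems.GenusExact.PlusDescent

end
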